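import Literature.NumberTheory.EllipticCurves.HypothesisSweep.Schema
import HarnessLib

/-!
# Hypothesis-sweep records, LEVEL I (Heegner index) — the index rows as data with an in-kernel recheck

Topic `NumberTheory/EllipticCurves`; namespace `Literature.NumberTheory.EllipticCurves.HypothesisSweep` (= this directory).
Extension of `Schema.lean` (read it first) by the rows that need a COMPUTED HEEGNER INDEX — Kolyvagin, Cha, Lawson–Wuthrich,
Jetchev, and Kolyvagin for CM curves at inert primes — for Cremona classes of analytic rank `1`.  Same design: computable DATA
records, a decidable recheck `ICurve.consistent`, generated sibling files `IRecords*.lean` with one theorem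
`isweep_<label> : ISwept [ … ] := by decide` per class; nothing about elliptic curves is asserted and nothing here is a named fact.

## What a level-I record adds to a level-T record

For `E` = curve `#1` of a class of analytic rank `1` and conductor `N`, a list of CERTIFIED HEEGNER FIELDS `K = ℚ(√D)`:
`D < 0` coprime to `N` with a witness `b`, `b² ≡ D (mod 4N)` (every prime dividing `N` splits in `K` — the Heegner hypothesis;
that `D` is a fundamental discriminant is an input), and for each the three integers the build's two engines computed
independently and identically (seat 1: PARI/GP; seat 2: engine `idx2`, AGM periods, baby-step-giant-step point counting and
ball arithmetic, no PARI; 71 623 (class, field) pairs diffed with zero disagreements at the time of writing):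
`S = L(E^D,1)·√|D| / Ω(E^D)`-normalised ∈ ℕ (so `S > 0` certifies `L(E^D,1) ≠ 0`, i.e. `E/K` has analytic rank `1`),
`τ = L′(E,1)·L(E^D,1)·√|D| / (‖ω‖²-normalised ĥ(P))`, `P` a generator of `E(ℚ)` modulo torsion, pinned to an integer and
factored as `τ = 2^e · I²` with `I` odd — by the Gross–Zagier formula [GrossZagier1986] `I` is, up to a power of `2` (units
of `K`, the Manin constant at `2`, the `2`-part of the index), the index `[E(K)/tors : ℤ·y_K]` of the Heegner point, so that
for an ODD prime `p`, `ord_p I` is the `ord_p` of the Heegner index read by the rows below (the build's SWEEP-SPEC §2: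
"certified `m` per Heegner `D`, bound `2·ord_p m`") — and the exact analytic Sha it implies, checked IN THE KERNEL against
the table value through the identity `τ · #E(ℚ)²_tors = Ш_an · 2 · S · ∏ c_ℓ` (the BSD quotient for `E/ℚ` combined with
Gross–Zagier; hypothesis H-TAB-SHA of the build is thereby discharged for the class rather than read from the table).

Per prime `p` of `S₀(E)` — and per EXCEPTIONAL prime: an odd `p ∉ S₀(E)` dividing `D·I` for every certified field, at which
the level-I tail below does not apply and which therefore gets its own entry decided by the level-T rows (`p ∉ S₀` means good
reduction, `ρ̄_{E,p}` surjective, `p ∤ #E(ℚ)_tors·∏c_ℓ·Ш_an`) — the record stores the level-T bits (`Schema.Bits`), three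
further bits read by the index rows (`IBits`: a curve in the isogeny class has a rational point of order `p`; for `p = 5`, the
quadratic twist `E^{(5)}` has no rational `5`-torsion; `max_{q ∣ N} ord_p c_q`), and the DECISION: status, the credited
level-T row with its flag or the credited index row with its flags and field, or the residual class.  `decidedI` RECOMPUTES it:
a pair already `proved` at level T stays so; otherwise the first flag-free applicable index row proves it; otherwise a level-T
literal row stands; otherwise a flagged index row (Jetchev at `p ∣ N` or over Cha's hypotheses) makes it literal; otherwise the
level-T residual class.  The level-I TAIL closes every odd prime outside the entries: non-CM — Kolyvagin [GJPST Thm 3.4 as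
below] needs `ρ̄_{E,p}` surjective (Zywina's set ⊆ `S₀`), `p ∤ D·I` for SOME certified field and `ord_p Ш_an = 0`; CM — Rubin at
split and Kolyvagin (Miller Thm 4.5(2b)) at inert good `p ≥ 5`; `ICurve.consistent` VERIFIES the tail's arithmetic side in the
kernel: every prime factor of `N` and of `#E(ℚ)_tors·∏c_ℓ·Ш_an` is an entry, `{2,3,5,7,11,13}` are entries, and every odd prime
dividing `gcd_K (|D_K|·I_K)` (= dividing `D·I` for every certified field) is an entry — by exact division, no primality test.

## The index rows (build tags T-KOLY, T-CHA, T-LW, T-JET, T-KOLYCM; hypotheses verbatim in the cited places)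

* `KOLY`   Kolyvagin 1990 with Gross–Zagier, as Grigorov–Jorza–Patrikis–Stein–Tarniţă, Math. Comp. 78 (2009) Thm 3.4 /
           Miller, LMS JCM 14 (2011) Thm 4.4: `E` non-CM of analytic rank `1`, `K` a Heegner field with `E/K` of analytic
           rank `1`, `p` odd, `p ∤ D_K`, `ρ̄_{E,p}` surjective ⇒ `ord_p #Ш(E/ℚ) ≤ 2·ord_p [E(K) : ℤy_K]`; with
           `ord_p I = 0 = ord_p Ш_an` the `p`-part of BSD holds.
* `CHA`    Cha, J. Number Theory 111 (2005) as Miller Thm 5.2: `p ∤ 2·D_K`, `p² ∤ N`, `E[p]` irreducible ⇒ the same bound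
           (used where surjectivity fails).
* `LW`     Lawson–Wuthrich, Springer PROMS 188 (2016) Thm 14 (correcting GJPST Thm 3.5): `p` odd, `p ∤ D_K`, no curve in the
           ℚ-isogeny class of `E` has a rational point of order `p`, for `p = 5` the twist `E^{(5)}` has no rational `5`-torsion,
           for `p = 11` `E ≠ 121c`; reducible `E[p]` allowed — then applied only when curve `#1` is the proven optimal curve
           (`optOk`: class of size `1` or Cremona's `opt_man` code `1`), since at a reducible `p` the index of a non-optimal curve
           may differ from the optimal one's by a power of `p` ⇒ the same bound.
* `JET`    Jetchev, Compos. Math. 144 (2008) Thm 1.1 as Miller Thm 5.4: under the hypotheses of `KOLY` or `CHA`,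
           `ord_p #Ш ≤ 2·(ord_p I − max_{q ∣ N} ord_p c_q)`; closes the pair when that bound is `0 = ord_p Ш_an`; LITERAL with
           flag `JETpN` when `p ∣ N` and `JETnonsurj` over Cha's hypotheses (the build's convention, referee note G28).
* `KOLYCM` Kolyvagin for CM curves as Miller Thm 4.5(2b): `E` CM, rank `1`, `p ≥ 5` good and inert in the CM field,
           `p ∤ D_K·I` ⇒ `Ш[p] = 0`; with `ord_p Ш_an = 0` the `p`-part of BSD.
Every index row additionally requires `ord_p Ш_an = 0` on curve `#1` (bit `vSha`).  `p = 2` is never decided here (`Up2`).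

Not here: the computation of `S`, `τ`, `I` or of any bit; any statement about elliptic curves; rank `0` (level T only).

References: [GrigorovJorzaPatrikisSteinTarnita2009] Thm 3.4, 3.5; [Miller2011LMS] Thm 4.4, 4.5, 5.2, 5.4; [LawsonWuthrich2016]
Thm 14; [Jetchev2008] Thm 1.1; [GrossZagier1986]; [Kolyvagin1990]; [Cremona2006] (tables `allbsd`, `allgens`, `opt_man`).
-/

namespace Literature.NumberTheory.EllipticCurves.HypothesisSweep

/-- The index rows (module docstring): `KOLY` [GJPST Thm 3.4 / Miller Thm 4.4], `CHA` [Miller Thm 5.2], `LW` [Lawson–Wuthrich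
Thm 14], `JET` [Jetchev / Miller Thm 5.4], `KOLYCM` [Miller Thm 4.5(2b)].
[cite: GrigorovJorzaPatrikisSteinTarnita2009, Thm 3.4 (p. 2406)] -/
inductive IRow
  | KOLY | CHA | LW | JET | KOLYCM
  deriving DecidableEq, Repr

/-- Literal flags of a credited index row: Jetchev's sharpening at a prime dividing the conductor (`JETpN`) or over Cha's
hypotheses, `ρ̄` not surjective (`JETnonsurj`). [folklore] -/
inductive IFlag
  | JETpN | JETnonsurj
  deriving DecidableEq, Repr

/-- The level-I tail: `KOLY` (non-CM rank 1: Kolyvagin at every odd prime outside the entries) or `RUBINKOLYCM` (CM rank 1: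
Rubin at split primes, Kolyvagin–Miller 4.5(2b) at inert good `p ≥ 5` outside the entries). Its arithmetic side is checked by
`ICurve.consistent`. [cite: Miller2011LMS, Thm 4.4 (p. 336)] -/
inductive ITail
  | KOLY | RUBINKOLYCM
  deriving DecidableEq, Repr

/-- Fuel-bounded `p`-adic valuation of a natural number (`0` for `n = 0` or `p ≤ 1`). [folklore] -/
def vpAux : ℕ → ℕ → ℕ → ℕ
  | 0, _, _ => 0
  | fuel + 1, p, n => if p ≤ 1 ∨ n = 0 ∨ n % p ≠ 0 then 0 else vpAux fuel p (n / p) + 1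

/-- `vp p n = ord_p n` for `n ≥ 1`, `p ≥ 2`. [folklore] -/
def vp (p n : ℕ) : ℕ := vpAux n p n

/-- Divide `n` by members `> 1` of `ps` as long as possible (fuel-bounded). [folklore] -/
def stripAux : ℕ → List ℕ → ℕ → ℕ
  | 0, _, n => n
  | fuel + 1, ps, n =>
    match ps.find? (fun p => decide (1 < p) && n % p == 0) with
    | some p => stripAux fuel ps (n / p)
    | none => n

/-- `strip ps n = 1` iff `n ≥ 1` and every prime divisor of `n` divides some member of `ps` — for a list of primes `ps`:
iff every prime factor of `n` is listed.  No primality test is involved. [folklore] -/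
def strip (ps : List ℕ) (n : ℕ) : ℕ := stripAux n ps n

/-- One certified Heegner field `K = ℚ(√D)` of a rank-1 class (module docstring): `D < 0`, `hw` with `hw² ≡ D (mod 4N)`,
`S > 0` and `τ = 2^twoExp · I²` (`I` odd) the two pinned integers, `I` the odd Heegner-index datum. [cite: GrossZagier1986, Thm I.6.3 (p. 230)] -/
structure FieldCert where
  D : ℤ
  hw : ℕ
  S : ℕ
  tau : ℕ
  twoExp : ℕ
  I : ℕ
  deriving DecidableEq, Repr

/-- Well-formedness of a field certificate for conductor `N`, torsion order `T`, Tamagawa product `tam` and table `Ш_an = sha`: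
`D < 0`, `gcd(D, N) = 1`, `hw² ≡ D (mod 4N)` (Heegner hypothesis), `S > 0`, `I` odd, `τ = 2^e·I²`, and the EXACT-SHA IDENTITY
`τ·T² = sha·2·S·tam`. [folklore] -/
def FieldCert.wf (N T tam sha : ℕ) (f : FieldCert) : Bool :=
  decide (f.D < 0) && (Int.gcd f.D N == 1) && ((((f.hw : ℤ) ^ 2 - f.D) % (4 * (N : ℤ))) == 0) &&
  decide (0 < f.S) && (f.I % 2 == 1) && (f.tau == 2 ^ f.twoExp * f.I ^ 2) &&
  (f.tau * T ^ 2 == sha * 2 * f.S * tam)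

/-- The further bits read by the index rows at `(E, p)`: `ptorsCls` = some curve of the ℚ-isogeny class has a rational point
of order `p`; `twist5ok` = (`p = 5`) the quadratic twist `E^{(5)}` has no rational point of order `5` (`true` at `p ≠ 5` by
convention); `vTamMax` = `max_{q ∣ N} ord_p c_q`. [cite: LawsonWuthrich2016, Thm 14 (p. 390)] -/
structure IBits where
  ptorsCls : Bool
  twist5ok : Bool
  vTamMax : ℕ
  deriving DecidableEq, Repr

/-- Class-level inputs of the index rows: `optOk` = curve `#1` is the proven `X₀(N)`-optimal curve (class of size 1 or
`opt_man` code 1); `is121c` = the class is `121c`; `T = #E(ℚ)_tors`, `tam = ∏ c_ℓ`, `sha` = table `Ш_an` of curve `#1`.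
[cite: Cremona2006, §1 (tables allbsd, opt_man)] -/
structure IClass where
  optOk : Bool
  is121c : Bool
  T : ℕ
  tam : ℕ
  sha : ℕ
  deriving DecidableEq, Repr

/-- The APPLICABLE INDEX ROWS at `(E, p)` from the certified fields, flag-free ones first (each list in field order), each with
its flags and the field `D` used; hypotheses verbatim as in the module docstring, `ord_p Ш_an = 0` throughout.
[cite: Miller2011LMS, Thm 5.2 (p. 338)] -/
def indexRows (h : Header) (c : IClass) (b : Bits) (x : IBits) (fs : List FieldCert) : List (IRow × List IFlag × ℤ) :=
  let p := b.p
  if p == 2 || b.vSha != 0 then [] else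
  let one (f : FieldCert) : List (IRow × List IFlag × ℤ) :=
    let vI := vp p f.I
    let pD := f.D % (p : ℤ) == 0
    if h.cm then
      (if decide (5 ≤ p) && b.good && b.cmInert && vI == 0 && !pD then [(.KOLYCM, [], f.D)] else [])
    else if vI == 0 && !pD then
      (if b.surj then [(.KOLY, [], f.D)] else if b.irr && !b.add then [(.CHA, [], f.D)] else []) ++
      (if (b.irr || c.optOk) && !x.ptorsCls && !(p == 11 && c.is121c) && (p != 5 || x.twist5ok)
        then [(.LW, [], f.D)] else [])
    else if decide (0 < vI) && !pD && (b.surj || (b.irr && !b.add)) && decide (vI ≤ x.vTamMax) then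
      [(.JET, (if !b.good then [IFlag.JETpN] else []) ++ (if !b.surj then [IFlag.JETnonsurj] else []), f.D)]
    else []
  let all := fs.flatMap one
  all.filter (fun r => r.2.1.isEmpty) ++ all.filter (fun r => !r.2.1.isEmpty)

/-- The level-I decision RECOMPUTED from the bits and the fields: (status, credited level-T row, its flags, credited index row,
its flags, its field, residual class) — see the module docstring for the order. [folklore] -/
def decidedI (h : Header) (c : IClass) (b : Bits) (x : IBits) (fs : List FieldCert) :
    Status × Option Row × List Flag × Option IRow × List IFlag × Option ℤ × Option Cls :=
  let t := decided h b
  if t.1 == .proved || t.1 == .unattempted then (t.1, t.2.1, t.2.2.1, none, [], none, t.2.2.2) else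
  let rows := indexRows h c b x fs
  match rows.find? (fun r => r.2.1.isEmpty), rows with
  | some (ir, _, D), _ => (.proved, none, [], some ir, [], some D, none)
  | none, (ir, fl, D) :: _ =>
      if t.1 == .literal then (t.1, t.2.1, t.2.2.1, none, [], none, none) else (.literal, none, [], some ir, fl, some D, none)
  | none, [] => (t.1, t.2.1, t.2.2.1, none, [], none, t.2.2.2)

/-- One `(E, p)` entry of a level-I record: level-T bits, index bits, and the recorded decision. [folklore] -/
structure IEntry where
  bits : Bits
  ibits : IBits
  status : Status
  trow : Option Row
  tflags : List Flag
  irow : Option IRow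
  iflags : List IFlag
  D : Option ℤ
  cls : Option Cls
  deriving DecidableEq, Repr

/-- An entry is consistent when its recorded decision is the recomputed one. [folklore] -/
def IEntry.consistent (h : Header) (c : IClass) (fs : List FieldCert) (e : IEntry) : Bool :=
  decidedI h c e.bits e.ibits fs == (e.status, e.trow, e.tflags, e.irow, e.iflags, e.D, e.cls)

/-- The level-I tail of a rank-1 class with a certified field. [folklore] -/
def itailOf (h : Header) : ITail := if h.cm then .RUBINKOLYCM else .KOLY

/-- One level-I class record: as `Curve`, plus the class inputs, the certified fields and level-I entries.
[cite: Cremona2006, §1 (labels, tables)] -/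
structure ICurve where
  label : String
  ainvs : List ℤ
  conductor : ℕ
  header : Header
  cls : IClass
  fields : List FieldCert
  entries : List IEntry
  tail : ITail
  verdict : Verdict
  engine : String
  deriving DecidableEq, Repr

/-- The class verdict over the odd primes (the level-I tail is `proved` once `consistent` holds). [folklore] -/
def iverdictOf (es : List IEntry) : Verdict :=
  if es.any (fun e => e.status == .residue) then .residue
  else if es.any (fun e => e.status == .literal) then .literal
  else .proved

/-- Consistency of a level-I record: five a-invariants; rank `1`; at least one field, all well-formed (Heegner witness, exact-Sha
identity); entries at increasing primes containing `2,3,5,7,11,13`, every prime factor of `N` and of `T·tam·sha`, and every odd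
prime dividing `|D|·I` for all fields (the exceptional primes) — checked by exact stripping; every entry consistent; tail and
verdict recomputed. [folklore] -/
def ICurve.consistent (c : ICurve) : Bool :=
  let ps := c.entries.map (·.bits.p)
  let g := c.fields.foldl (fun a f => Nat.gcd a (f.D.natAbs * f.I)) 0
  (c.ainvs.length == 5) && (c.header.rank == 1) &&
  !c.fields.isEmpty && c.fields.all (FieldCert.wf c.conductor c.cls.T c.cls.tam c.cls.sha) &&
  ps.Pairwise (· < ·) && [2, 3, 5, 7, 11, 13].all (fun q => ps.contains q) &&
  (strip ps c.conductor == 1) && (strip ps (c.cls.T * c.cls.tam * c.cls.sha) == 1) && (strip (2 :: ps) g == 1) &&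
  c.entries.all (IEntry.consistent c.header c.cls c.fields) &&
  (c.tail == itailOf c.header) && (c.verdict == iverdictOf c.entries)

/-- A list of level-I records is `ISwept` when every one is consistent: the statement of each generated theorem
`theorem isweep_<label> : ISwept [ … ] := by decide` of the files `IRecords*.lean`. [folklore] -/
def ISwept (cs : List ICurve) : Prop := cs.all ICurve.consistent = true

/-- `ISwept cs` is decidable. [folklore] -/
instance ISwept.instDecidable (cs : List ICurve) : Decidable (ISwept cs) :=
  inferInstanceAs (Decidable (cs.all ICurve.consistent = true))

/-- Unpacking `ISwept`. [folklore] -/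
theorem ISwept.consistent_of_mem {cs : List ICurve} (h : ISwept cs) {c : ICurve} (hc : c ∈ cs) :
    c.consistent = true :=
  List.all_eq_true.1 h c hc

/-- The empty level-I sweep. [folklore] -/
theorem ISwept.nil : ISwept [] := by decide

/-- SAMPLE (and regression test of the recheck): `43a1` (`N = 43`, rank 1, non-CM, semistable; `S₀ = {2,3,5,7,11,13,43}`, no
exceptional prime; Heegner fields `ℚ(√−7)` (`49 ≡ −7 (mod 172)`) and `ℚ(√−8)` with `S = 2`, `τ = 4 = 2²·1²`, `I = 1`, exact
`Ш_an = 1` (`4·1² = 1·2·2·1`)): at `3, 5, 11, 13` Jetchev–Skinner–Wan (good ordinary, semistable) already at level T; at `7` (good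
supersingular: JSW would be literal) Kolyvagin with `K = ℚ(√−8)` (`7 ∤ 8·1`, `ρ̄₇` onto); at `43` (non-split multiplicative, residual
class X11b at level T) Kolyvagin with `K = ℚ(√−7)`; tail Kolyvagin; verdict `proved`.  Values from seat 2's job `j046226`, equal to
seat 1's. [cite: GrigorovJorzaPatrikisSteinTarnita2009, Thm 3.4 (p. 2406)] -/
theorem iswept_sample : ISwept [
  { label := "43a1", ainvs := [0, 1, 1, 0, 0], conductor := 43, header := ⟨1, false, true⟩, cls := ⟨true, false, 1, 1, 1⟩,
    fields := [⟨-7, 49, 2, 4, 2, 1⟩, ⟨-8, 140, 2, 4, 2, 1⟩],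
    entries := [
      ⟨⟨2, .goodSS, -2, false, true, true, 0, 0, 0, [], true, false, false, false⟩, ⟨false, true, 0⟩, .unattempted, none, [], none, [], none, (some .Up2)⟩,
      ⟨⟨3, .goodOrd, -2, false, true, true, 0, 0, 0, [], true, false, false, false⟩, ⟨false, true, 0⟩, .proved, (some .JSW), [], none, [], none, none⟩,
      ⟨⟨5, .goodOrd, -4, false, true, true, 0, 0, 0, [], true, false, false, false⟩, ⟨false, true, 0⟩, .proved, (some .JSW), [], none, [], none, none⟩,
      ⟨⟨7, .goodSS, 0, false, true, true, 0, 0, 0, [], true, false, false, false⟩, ⟨false, true, 0⟩, .proved, none, [], (some .KOLY), [], (some (-8)), none⟩,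
      ⟨⟨11, .goodOrd, 3, false, true, true, 0, 0, 0, [], true, false, false, false⟩, ⟨false, true, 0⟩, .proved, (some .JSW), [], none, [], none, none⟩,
      ⟨⟨13, .goodOrd, -5, false, true, true, 0, 0, 0, [], true, false, false, false⟩, ⟨false, true, 0⟩, .proved, (some .JSW), [], none, [], none, none⟩,
      ⟨⟨43, .nonsplit, -1, false, true, false, 0, 0, 0, [], true, false, false, false⟩, ⟨false, true, 0⟩, .proved, none, [], (some .KOLY), [], (some (-7)), none⟩],
    tail := .KOLY, verdict := .proved, engine := "idx2/1 + rows3 (seat 2, kurihara)" } ] := by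
  decide

/-- Tampering is caught (1): crediting Kolyvagin at `7` with the field `ℚ(√−7)` (in which `7` ramifies) is NOT consistent. [folklore] -/
theorem not_iswept_tampered_field : ¬ ISwept [
  { label := "43a1", ainvs := [0, 1, 1, 0, 0], conductor := 43, header := ⟨1, false, true⟩, cls := ⟨true, false, 1, 1, 1⟩,
    fields := [⟨-7, 49, 2, 4, 2, 1⟩, ⟨-8, 140, 2, 4, 2, 1⟩],
    entries := [
      ⟨⟨2, .goodSS, -2, false, true, true, 0, 0, 0, [], true, false, false, false⟩, ⟨false, true, 0⟩, .unattempted, none, [], none, [], none, (some .Up2)⟩,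
      ⟨⟨3, .goodOrd, -2, false, true, true, 0, 0, 0, [], true, false, false, false⟩, ⟨false, true, 0⟩, .proved, (some .JSW), [], none, [], none, none⟩,
      ⟨⟨5, .goodOrd, -4, false, true, true, 0, 0, 0, [], true, false, false, false⟩, ⟨false, true, 0⟩, .proved, (some .JSW), [], none, [], none, none⟩,
      ⟨⟨7, .goodSS, 0, false, true, true, 0, 0, 0, [], true, false, false, false⟩, ⟨false, true, 0⟩, .proved, none, [], (some .KOLY), [], (some (-7)), none⟩,
      ⟨⟨11, .goodOrd, 3, false, true, true, 0, 0, 0, [], true, false, false, false⟩, ⟨false, true, 0⟩, .proved, (some .JSW), [], none, [], none, none⟩,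
      ⟨⟨13, .goodOrd, -5, false, true, true, 0, 0, 0, [], true, false, false, false⟩, ⟨false, true, 0⟩, .proved, (some .JSW), [], none, [], none, none⟩,
      ⟨⟨43, .nonsplit, -1, false, true, false, 0, 0, 0, [], true, false, false, false⟩, ⟨false, true, 0⟩, .proved, none, [], (some .KOLY), [], (some (-7)), none⟩],
    tail := .KOLY, verdict := .proved, engine := "idx2/1 + rows3 (seat 2, kurihara)" } ] := by
  decide

/-- Tampering is caught (2): a field whose exact-Sha identity fails (`S = 3`: `4·1² ≠ 1·2·3·1`), or omitting the entry at the
prime `43 ∣ N`, is NOT consistent. [folklore] -/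
theorem not_iswept_tampered_sha : ¬ ISwept [
  { label := "43a1", ainvs := [0, 1, 1, 0, 0], conductor := 43, header := ⟨1, false, true⟩, cls := ⟨true, false, 1, 1, 1⟩,
    fields := [⟨-7, 49, 3, 4, 2, 1⟩],
    entries := [
      ⟨⟨2, .goodSS, -2, false, true, true, 0, 0, 0, [], true, false, false, false⟩, ⟨false, true, 0⟩, .unattempted, none, [], none, [], none, (some .Up2)⟩,
      ⟨⟨3, .goodOrd, -2, false, true, true, 0, 0, 0, [], true, false, false, false⟩, ⟨false, true, 0⟩, .proved, (some .JSW), [], none, [], none, none⟩,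
      ⟨⟨5, .goodOrd, -4, false, true, true, 0, 0, 0, [], true, false, false, false⟩, ⟨false, true, 0⟩, .proved, (some .JSW), [], none, [], none, none⟩,
      ⟨⟨7, .goodSS, 0, false, true, true, 0, 0, 0, [], true, false, false, false⟩, ⟨false, true, 0⟩, .literal, (some .JSW), [.JSWss], none, [], none, none⟩,
      ⟨⟨11, .goodOrd, 3, false, true, true, 0, 0, 0, [], true, false, false, false⟩, ⟨false, true, 0⟩, .proved, (some .JSW), [], none, [], none, none⟩,
      ⟨⟨13, .goodOrd, -5, false, true, true, 0, 0, 0, [], true, false, false, false⟩, ⟨false, true, 0⟩, .proved, (some .JSW), [], none, [], none, none⟩],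
    tail := .KOLY, verdict := .literal, engine := "idx2/1 + rows3 (seat 2, kurihara)" } ] := by
  decide

/-- `vp` on small cases. [folklore] -/
example : vp 3 45 = 2 ∧ vp 5 45 = 1 ∧ vp 7 45 = 0 ∧ vp 3 1 = 0 := by decide

/-- `strip` on small cases: `660 = 2²·3·5·11`. [folklore] -/
example : strip [2, 3, 5, 11] 660 = 1 ∧ strip [2, 3, 5] 660 = 11 := by decide

end Literature.NumberTheory.EllipticCurves.HypothesisSweep
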